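import Mathlib

/-!
# At a tamely ramified quadratic place a non-square unit is not a norm ((A8a), tame case)

Item (A8a) of `route/TIER5.md` §N5.12.6 reads: «at a ramified `v`, `η_v` is non-trivial on
`U_{F_v}` (a quadratic character of `F_v^×` trivial on `U_{F_v}` is unramified and corresponds
to the unramified quadratic extension; `E_v/F_v` is ramified)» — an appeal to local class field
theory. With `η_v` the norm character of `E_v/F_v` (`η_v(x) = 1` iff `x` is a norm from `E_v^×`,
the definition of `ω_{E_v/F_v}` through local class field theory), the TAME case has a direct
computation, checked here: if `O_E = O_F[θ]` with `θ² = π` a uniformiser of `O_F` (the tame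
ramified integral basis) and `σ θ = −θ`, then

* `norm_basis`: `N(a + bθ) = (a + bθ)·σ(a + bθ) = a² − π b²`;
* `isUnit_of_isUnit_add_mul`: the `O_F`-coordinate `a` of a unit `a + bθ` of `O_E` is a unit;
* `not_exists_norm_eq`: a unit `u` of `O_F` that is not a square modulo `π` is NOT of the form
  `N(s)/N(t)` with `s, t ∈ O_E`, `t ≠ 0` — i.e. not the norm of any element of `E_v^×`
  (`N(s) = u N(t)` forces, after cancelling the common `θ`-power, `u ≡ (a/c)² (mod π)`);
* `exists_unit_not_norm`: when the residue field of `O_F` is finite of odd characteristic, such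
  a unit `u` exists (`FiniteField.exists_nonsquare`), hence «`η_v` is non-trivial on `U_{F_v}`».

What is NOT here: the identification of `η_v` with the norm character (local class field
theory, the prose's (A8a) route) and the wild case `p = 2`.
Declaration per README §8(d): «uses an L-value-free non-vanishing device: NO».
-/

namespace Summit.Ventures.HodgeRepro2.T5TameRamifiedNonNorm

variable {R S : Type*} [CommRing R] [CommRing S] [Algebra R S]

section Basis

variable (σ : S ≃+* S) (hσ : ∀ r : R, σ (algebraMap R S r) = algebraMap R S r) {θ : S} {π : R}
  (hθ2 : θ ^ 2 = algebraMap R S π) (hσθ : σ θ = -θ)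

include hσ hθ2 hσθ in
/-- `N(a + bθ) = a² − π b²`. -/
theorem norm_basis (a b : R) :
    (algebraMap R S a + algebraMap R S b * θ) * σ (algebraMap R S a + algebraMap R S b * θ) =
      algebraMap R S (a ^ 2 - π * b ^ 2) := by
  rw [map_add, map_mul, hσ, hσ, hσθ, map_sub, map_pow, map_mul, map_pow, ← hθ2]
  ring

end Basis

section DVR

variable [IsDomain R] [IsDiscreteValuationRing R] [IsDomain S] [IsDiscreteValuationRing S]
variable {θ : S} {π : R}

omit [IsDomain S] [IsDiscreteValuationRing S] in
/-- If `a + bθ` is a unit of `S` and `θ` is a non-unit with `θ² = π`, then `a` is a unit of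
`R` (otherwise `π ∣ a` and `a + bθ ∈ θ S`). -/
theorem isUnit_of_isUnit_add_mul (hπ : Irreducible π) (hθ : Irreducible θ)
    (hθ2 : θ ^ 2 = algebraMap R S π) {a b : R}
    (h : IsUnit (algebraMap R S a + algebraMap R S b * θ)) : IsUnit a := by
  by_contra ha
  have hmem : a ∈ IsLocalRing.maximalIdeal R :=
    (IsLocalRing.mem_maximalIdeal a).2 (mem_nonunits_iff.2 ha)
  rw [(IsDiscreteValuationRing.irreducible_iff_uniformizer π).1 hπ, Ideal.mem_span_singleton] at hmem
  obtain ⟨a', rfl⟩ := hmem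
  have e : algebraMap R S (π * a') + algebraMap R S b * θ = θ * (θ * algebraMap R S a' + algebraMap R S b) := by
    rw [map_mul, ← hθ2]
    ring
  rw [e] at h
  exact hθ.not_isUnit (isUnit_of_mul_isUnit_left h)

omit [IsDomain R] [IsDiscreteValuationRing R] [IsDomain S] [IsDiscreteValuationRing S] in
/-- `σ (θ ^ k) = (−1)^k θ^k` when `σ θ = −θ`. -/
theorem sigma_pow (σ : S ≃+* S) (hσθ : σ θ = -θ) (k : ℕ) : σ (θ ^ k) = (-1) ^ k * θ ^ k := by
  rw [map_pow, hσθ, neg_pow]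

omit [IsDomain R] [IsDiscreteValuationRing R] [IsDomain S] [IsDiscreteValuationRing S] in
/-- The norm of `s₀ θ^k` is `(s₀ σ s₀ (−1)^k) θ^(2k)`. -/
theorem norm_mul_pow (σ : S ≃+* S) (hσθ : σ θ = -θ) (s₀ : S) (k : ℕ) :
    (s₀ * θ ^ k) * σ (s₀ * θ ^ k) = (s₀ * σ s₀ * (-1) ^ k) * θ ^ (2 * k) := by
  rw [map_mul, sigma_pow σ hσθ, two_mul, pow_add]
  ring

/-- A unit `u` of `R` that is not a square modulo `π` is not a norm: there are no `s, t ∈ S`,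
`t ≠ 0`, with `s · σ s = u · (t · σ t)`. -/
theorem not_exists_norm_eq (σ : S ≃+* S) (hσ : ∀ r : R, σ (algebraMap R S r) = algebraMap R S r)
    (hinj : Function.Injective (algebraMap R S)) (hπ : Irreducible π) (hθ : Irreducible θ)
    (hθ2 : θ ^ 2 = algebraMap R S π) (hσθ : σ θ = -θ)
    (hbasis : ∀ s : S, ∃ a b : R, s = algebraMap R S a + algebraMap R S b * θ) {u : R}
    (hu : ∀ a : R, ¬ π ∣ u - a ^ 2) :
    ¬ ∃ s t : S, t ≠ 0 ∧ s * σ s = algebraMap R S u * (t * σ t) := by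
  rintro ⟨s, t, ht, h⟩
  -- `u` is a unit of `R`: otherwise `π ∣ u = u − 0²`
  have hu0 : IsUnit u := by
    by_contra hnu
    have hmem : u ∈ IsLocalRing.maximalIdeal R :=
      (IsLocalRing.mem_maximalIdeal u).2 (mem_nonunits_iff.2 hnu)
    rw [(IsDiscreteValuationRing.irreducible_iff_uniformizer π).1 hπ,
      Ideal.mem_span_singleton] at hmem
    exact hu 0 (by simpa using hmem)
  have huS : IsUnit (algebraMap R S u) := hu0.map (algebraMap R S)
  -- `s ≠ 0`
  have hs : s ≠ 0 := by
    rintro rfl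
    rw [zero_mul] at h
    have : algebraMap R S u * (t * σ t) ≠ 0 :=
      mul_ne_zero huS.ne_zero (mul_ne_zero ht (by simpa using ht))
    exact this h.symm
  -- decompose along the uniformiser `θ`
  obtain ⟨k, s₀, hs₀⟩ := IsDiscreteValuationRing.eq_unit_mul_pow_irreducible hs hθ
  obtain ⟨m, t₀, ht₀⟩ := IsDiscreteValuationRing.eq_unit_mul_pow_irreducible ht hθ
  rw [hs₀, ht₀, norm_mul_pow σ hσθ, norm_mul_pow σ hσθ, ← mul_assoc] at h
  -- compare the `θ`-exponents: `k = m`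
  have hU : IsUnit ((s₀ : S) * σ s₀ * (-1) ^ k) :=
    (s₀.isUnit.mul (s₀.isUnit.map σ)).mul ((isUnit_one.neg).pow k)
  have hV : IsUnit (algebraMap R S u * ((t₀ : S) * σ t₀ * (-1) ^ m)) :=
    huS.mul ((t₀.isUnit.mul (t₀.isUnit.map σ)).mul ((isUnit_one.neg).pow m))
  have hkm : 2 * k = 2 * m := by
    refine IsDiscreteValuationRing.unit_mul_pow_congr_pow hθ hθ hU.unit hV.unit (2 * k) (2 * m) ?_
    rw [hU.unit_spec, hV.unit_spec]
    exact h
  have hk : k = m := by omega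
  subst hk
  -- cancel `θ^(2k)` and `(−1)^k`
  have h1 : (s₀ : S) * σ s₀ * (-1) ^ k = algebraMap R S u * ((t₀ : S) * σ t₀ * (-1) ^ k) :=
    mul_right_cancel₀ (pow_ne_zero _ hθ.ne_zero) h
  have h2 : (s₀ : S) * σ s₀ = algebraMap R S u * ((t₀ : S) * σ t₀) := by
    have hne : ((-1 : S) ^ k) ≠ 0 := pow_ne_zero _ (neg_ne_zero.2 one_ne_zero)
    apply mul_right_cancel₀ hne
    rw [h1]
    ring
  -- the basis coordinates
  obtain ⟨a, b, hab⟩ := hbasis s₀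
  obtain ⟨c, d, hcd⟩ := hbasis t₀
  rw [hab, hcd, norm_basis σ hσ hθ2 hσθ, norm_basis σ hσ hθ2 hσθ, ← map_mul] at h2
  have h3 : a ^ 2 - π * b ^ 2 = u * (c ^ 2 - π * d ^ 2) := hinj h2
  -- `c` is a unit of `R`
  have hc : IsUnit c := isUnit_of_isUnit_add_mul hπ hθ hθ2 (hcd ▸ t₀.isUnit)
  obtain ⟨cu, rfl⟩ := hc
  -- `u ≡ (a / c)² (mod π)`
  apply hu (a * ((cu⁻¹ : Rˣ) : R))
  refine ⟨-(b ^ 2 - u * d ^ 2) * ((cu⁻¹ : Rˣ) : R) ^ 2, ?_⟩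
  have hcu : ((cu : R) * ((cu⁻¹ : Rˣ) : R)) = 1 := Units.mul_inv cu
  linear_combination (-(((cu⁻¹ : Rˣ) : R) ^ 2)) * h3 + (-(u * ((cu : R) * ((cu⁻¹ : Rˣ) : R) + 1))) * hcu

/-- With a finite residue field of odd characteristic, some unit of `R` is not a square modulo
`π` (a lift of a non-square of the residue field). -/
theorem exists_unit_not_sq_mod (hπ : Irreducible π) [Finite (IsLocalRing.ResidueField R)]
    (h2 : ringChar (IsLocalRing.ResidueField R) ≠ 2) :
    ∃ u : R, IsUnit u ∧ ∀ a : R, ¬ π ∣ u - a ^ 2 := by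
  obtain ⟨ā, hā⟩ := FiniteField.exists_nonsquare h2
  obtain ⟨u, rfl⟩ := IsLocalRing.residue_surjective ā
  have hmax : IsLocalRing.maximalIdeal R = Ideal.span {π} :=
    (IsDiscreteValuationRing.irreducible_iff_uniformizer π).1 hπ
  refine ⟨u, ?_, fun a hdvd => hā ?_⟩
  · by_contra hnu
    apply hā
    have : IsLocalRing.residue R u = 0 := by
      rw [IsLocalRing.residue_eq_zero_iff]
      exact (IsLocalRing.mem_maximalIdeal u).2 (mem_nonunits_iff.2 hnu)
    rw [this]
    exact ⟨0, by simp⟩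
  · refine ⟨IsLocalRing.residue R a, ?_⟩
    have hmem : u - a ^ 2 ∈ IsLocalRing.maximalIdeal R := by
      rw [hmax, Ideal.mem_span_singleton]
      exact hdvd
    have := (IsLocalRing.residue_eq_zero_iff _).2 hmem
    rw [map_sub, map_pow, sub_eq_zero] at this
    rw [this, sq]

/-- (A8a), TAME CASE: at a tamely ramified quadratic place (`O_E = O_F[θ]`, `θ² = π`,
`σ θ = −θ`) with residue field of odd characteristic, some unit of `O_F` is not a norm from
`E_v^×` — «the norm character `η_v` is non-trivial on `U_{F_v}`». -/
theorem exists_unit_not_norm (σ : S ≃+* S) (hσ : ∀ r : R, σ (algebraMap R S r) = algebraMap R S r)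
    (hinj : Function.Injective (algebraMap R S)) (hπ : Irreducible π) (hθ : Irreducible θ)
    (hθ2 : θ ^ 2 = algebraMap R S π) (hσθ : σ θ = -θ)
    (hbasis : ∀ s : S, ∃ a b : R, s = algebraMap R S a + algebraMap R S b * θ)
    [Finite (IsLocalRing.ResidueField R)] (h2 : ringChar (IsLocalRing.ResidueField R) ≠ 2) :
    ∃ u : R, IsUnit u ∧ ¬ ∃ s t : S, t ≠ 0 ∧ s * σ s = algebraMap R S u * (t * σ t) := by
  obtain ⟨u, hu, hsq⟩ := exists_unit_not_sq_mod hπ h2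
  exact ⟨u, hu, not_exists_norm_eq σ hσ hinj hπ hθ hθ2 hσθ hbasis hsq⟩

end DVR

end Summit.Ventures.HodgeRepro2.T5TameRamifiedNonNorm
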